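import Mathlib
import HarnessLib
import Summits.ResolutionOfSingularities.ResolutionOfSingularities.Theorems.WildQuotientsWildQuotientResolutionS1aOneShotKillLocal
import Summits.ResolutionOfSingularities.ResolutionOfSingularities.Theorems.WildQuotientsWildQuotientResolutionS1aInvariantsFlat

/-!
# S1a — (T2e, N3) GLOBAL KIRÁLY–LÜTKEBOHMERT: the ring of invariants of a regular ring under an automorphism of prime order
# with principal augmentation ideal is regular

[OURS · L1 W4.5c · lead-1 g7; T2E-BRIEF (N3)] — NOT statements of the manuscript; counted 0; AI-level work, weaker than expert
review. Crux stmt-ResolutionOfSingularities-17941, line `s1a-logminvertex` v6, stub `stub_winningStrategy` ((R0) branch: after the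
one-shot kill `augmentationIdeal σʼ = (s)` on a chart ring, `…S1aOneShotKillChart(Shift)`, the invariants of the chart ring must be
regular GLOBALLY on the chart, at σʼ-fixed AND σʼ-moved points).

* `moved_of_not_stable` — if one prime over `𝔮` is not `τ`-stable, none is (transitivity `exists_pow_map_eq_of_under_eq`);
* `isRegularLocalRing_atPrime_of_stable` — STABLE prime `𝔓` over `𝔮`: `A_𝔮 ≃ (C_𝔓)^{τ_𝔓}` ((SAT) + (N1)) and gen-6 (e2)
  `OneShotKill.isRegularLocalRing_invariantSubring_atPrime` (Király–Lütkebohmert, tree theorem `KiralyLutkebohmertRegularity_holds`);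
* **`isRegularRing_invariantSubring`** — `C` regular, `τ^[p] = id` (`p` prime), `augmentationIdeal τ` principal, `A = invariantSubring τ`
  Noetherian ⇒ `A` is a regular ring (stable primes: K–L; moved primes: `isRegularLocalRing_atPrime_of_moved`, CHR + flat descent);
* `isNoetherianRing_invariantSubring` / `exists_finset_closure_of_finiteType` — Noetherianity (and finite generation) of `A` when `C` is of
  finite type over a Noetherian ring `R₀` fixed by `τ` (E. Noether's argument: `C` integral and of finite type over `A` ⇒ module-finite;
  Artin–Tate `fg_of_fg_of_fg`).
-/

set_option linter.dupNamespace false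

noncomputable section

namespace Summit.ResolutionOfSingularities.ResolutionOfSingularities.Theorems.WildQuotientResolution.S1.InvariantsRegular

open Literature.AlgebraicGeometry.Resolution
open scoped Pointwise

universe u v

variable {C : Type u} [CommRing C] (τ : C ≃+* C)

/-! ## One moved prime over `𝔮` ⇒ all primes over `𝔮` are moved -/

/-- Membership in the image of an ideal under a power of `τ`. -/
theorem mem_map_pow_iff (k : ℕ) (I : Ideal C) (y : C) :
    y ∈ I.map ((τ ^ k : C ≃+* C) : C →+* C) ↔ (τ ^ k).symm y ∈ I := by
  rw [Ideal.map_comap_of_equiv]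
  rfl

/-- If some prime `𝔓` over `𝔮` is not `τ`-stable then every prime over `𝔮` contains an element moved out of it by `τ`.
[OURS · L1 W4.5c] -/
theorem moved_of_not_stable {p : ℕ} (hp : 0 < p) (hτp : ∀ x : C, τ^[p] x = x) (𝔮 : Ideal (invariantSubring τ))
    (𝔓 : Ideal C) [𝔓.IsPrime] [h𝔓𝔮 : 𝔓.LiesOver 𝔮] (hns : ¬ ∀ x, x ∈ 𝔓 ↔ τ x ∈ 𝔓)
    (P : Ideal C) [P.IsPrime] [hP𝔮 : P.LiesOver 𝔮] : ∃ x ∈ P, τ x ∉ P := by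
  by_contra hcon
  push Not at hcon
  have hPst := stable_iff_of_forall_mem τ hp hτp (P := P) hcon
  obtain ⟨k, -, hk⟩ := exists_pow_map_eq_of_under_eq τ hp hτp 𝔓 P (by rw [← h𝔓𝔮.over, ← hP𝔮.over])
  apply hns
  intro x
  have h1 : ∀ y, y ∈ 𝔓 ↔ (τ ^ k) y ∈ P := fun y => by
    rw [hk, mem_map_pow_iff, RingEquiv.symm_apply_apply]
  rw [h1, h1, hPst ((τ ^ k) x), pow_apply, pow_apply, ← Function.iterate_succ_apply, Function.iterate_succ_apply']

/-! ## Stable primes: `A_𝔮 ≃ (C_𝔓)^{τ_𝔓}` and Király–Lütkebohmert -/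

section Stable

variable (𝔓 : Ideal C) [𝔓.IsPrime] (𝔮 : Ideal (invariantSubring τ)) [𝔮.IsPrime] [𝔓.LiesOver 𝔮]

/-- A `τ`-stable prime has `τ`-stable complement (the hypothesis `H` of `IsLocalization.ringEquivOfRingEquiv`). -/
theorem map_primeCompl_eq_of_stable (h𝔓 : ∀ x, x ∈ 𝔓 ↔ τ x ∈ 𝔓) : 𝔓.primeCompl.map τ.toMonoidHom = 𝔓.primeCompl := by
  ext x
  constructor
  · rintro ⟨y, hy, rfl⟩
    exact fun h => hy ((h𝔓 y).mpr h)
  · intro hx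
    refine ⟨τ.symm x, fun h => hx ?_, τ.apply_symm_apply x⟩
    have h' : τ (τ.symm x) ∈ 𝔓 := (h𝔓 (τ.symm x)).mp h
    rwa [τ.apply_symm_apply] at h'

/-- **Regularity of `A_𝔮` under a STABLE prime** `𝔓`: `A_𝔮` is isomorphic to the ring of invariants of the induced automorphism
`τ_𝔓` of `C_𝔓` ((SAT) + (N1)), which is regular by Király–Lütkebohmert (gen-6 (e2)) when `C` is regular, `τ^[p] = id` with `p`
prime and `augmentationIdeal τ` is principal. [OURS · L1 W4.5c] -/
theorem isRegularLocalRing_atPrime_of_stable [IsRegularRing C] {p : ℕ} (hp : p.Prime) (hτp : ∀ x : C, τ^[p] x = x)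
    (hI : (augmentationIdeal τ).IsPrincipal) (h𝔓 : ∀ x, x ∈ 𝔓 ↔ τ x ∈ 𝔓) :
    IsRegularLocalRing (Localization.AtPrime 𝔮) := by
  have H := map_primeCompl_eq_of_stable τ 𝔓 h𝔓
  haveI hreg : IsRegularLocalRing (invariantSubring
      (IsLocalization.ringEquivOfRingEquiv (Localization.AtPrime 𝔓) (Localization.AtPrime 𝔓) τ H)) :=
    Summit.ResolutionOfSingularities.ResolutionOfSingularities.Theorems.WildQuotientResolution.S1.OneShotKill.isRegularLocalRing_invariantSubring_atPrime
      τ 𝔓 H hp hτp hI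
  -- (SAT): `C_𝔓` is the localisation at the image `S` of `A ∖ 𝔮`
  haveI hS := isLocalization_algebraMapSubmonoid_of_stable τ 𝔓 𝔮 hp.pos hτp h𝔓
  haveI : IsLocalization (𝔮.primeCompl.map (algebraMap (invariantSubring τ) C)) (Localization.AtPrime 𝔓) := hS
  -- `ψ : A_𝔮 → C_𝔓`
  let ψ : Localization.AtPrime 𝔮 →+* Localization.AtPrime 𝔓 :=
    IsLocalization.map (Localization.AtPrime 𝔓) (algebraMap (invariantSubring τ) C)
      (show 𝔮.primeCompl ≤ (Algebra.algebraMapSubmonoid C 𝔮.primeCompl).comap _ from Submonoid.le_comap_map _)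
  have hψinj : Function.Injective ψ :=
    IsLocalization.map_injective_of_injective _ _ _ Subtype.val_injective
  -- its image is fixed by `τ_𝔓`
  have hφ : ∀ c : C, IsLocalization.ringEquivOfRingEquiv (Localization.AtPrime 𝔓) (Localization.AtPrime 𝔓) τ H
      (algebraMap C _ c) = algebraMap C _ (τ c) := fun c => IsLocalization.ringEquivOfRingEquiv_eq H c
  have hmem : ∀ x, ψ x ∈ invariantSubring
      (IsLocalization.ringEquivOfRingEquiv (Localization.AtPrime 𝔓) (Localization.AtPrime 𝔓) τ H) := by
    intro x
    rw [mem_invariantSubring_iff]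
    have h : (((IsLocalization.ringEquivOfRingEquiv (Localization.AtPrime 𝔓) (Localization.AtPrime 𝔓) τ H :
        _ ≃+* _) : _ →+* _).comp ψ).comp (algebraMap (invariantSubring τ) (Localization.AtPrime 𝔮)) =
        ψ.comp (algebraMap (invariantSubring τ) (Localization.AtPrime 𝔮)) := by
      ext a
      simp only [RingHom.coe_comp, RingHom.coe_coe, Function.comp_apply, ψ, IsLocalization.map_eq]
      rw [hφ]
      exact congrArg _ a.2
    exact congrArg (fun f => f x) (IsLocalization.ringHom_ext 𝔮.primeCompl h)
  -- and every `τ_𝔓`-fixed element is in the image ((N1))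
  have hsurj : ∀ y ∈ invariantSubring
      (IsLocalization.ringEquivOfRingEquiv (Localization.AtPrime 𝔓) (Localization.AtPrime 𝔓) τ H), ∃ x, ψ x = y := by
    intro y hy
    obtain ⟨c, t, hc, rfl⟩ := exists_fixed_mk'_of_apply_eq τ (Algebra.algebraMapSubmonoid C 𝔮.primeCompl)
      (algebraMapSubmonoid_fixed τ 𝔮) _ hφ hy
    obtain ⟨_, ⟨s, hs, rfl⟩⟩ := t
    exact ⟨IsLocalization.mk' _ (⟨c, hc⟩ : invariantSubring τ) ⟨s, hs⟩, IsLocalization.map_mk' _ _ _⟩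
  let e := RingEquiv.ofBijective (ψ.codRestrict _ hmem)
    ⟨fun x y hxy => hψinj (congrArg Subtype.val hxy), fun y => by
      obtain ⟨x, hx⟩ := hsurj y.1 y.2
      exact ⟨x, Subtype.ext hx⟩⟩
  exact IsRegularLocalRing.of_ringEquiv e.symm

end Stable

/-! ## The global theorem -/

/-- **GLOBAL KIRÁLY–LÜTKEBOHMERT.** Let `C` be a regular ring, `τ` a ring automorphism with `τ^[p] = id`, `p` prime, whose
augmentation ideal `(τ c - c : c ∈ C)` is principal, and suppose the ring of invariants `A = C^τ` is Noetherian (e.g.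
`isNoetherianRing_invariantSubring`). Then `A` is a regular ring: at a prime `𝔮` under a `τ`-stable prime this is Király–Lütkebohmert
on `C_𝔓` (`isRegularLocalRing_atPrime_of_stable`); under a free orbit `A_𝔮 → C_𝔓` is flat (Chase–Harrison–Rosenberg) and regularity
descends (`isRegularLocalRing_atPrime_of_moved`). [OURS · L1 W4.5c] -/
theorem isRegularRing_invariantSubring [IsRegularRing C] [IsNoetherianRing (invariantSubring τ)] {p : ℕ} (hp : p.Prime)
    (hτp : ∀ x : C, τ^[p] x = x) (hI : (augmentationIdeal τ).IsPrincipal) : IsRegularRing (invariantSubring τ) := by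
  refine isRegularRing_iff.mpr fun 𝔮 _ => ?_
  haveI := isIntegral_invariantSubring τ hp.pos hτp
  obtain ⟨𝔓, h𝔓, h𝔓𝔮⟩ := (inferInstance : Nonempty (𝔮.primesOver C))
  by_cases hst : ∀ x, x ∈ 𝔓 ↔ τ x ∈ 𝔓
  · exact isRegularLocalRing_atPrime_of_stable τ 𝔓 𝔮 hp hτp hI hst
  · exact isRegularLocalRing_atPrime_of_moved τ 𝔓 𝔮 hp hτp (fun P _ _ => moved_of_not_stable τ hp.pos hτp 𝔮 𝔓 hst P)

/-! ## Noetherianity of the invariants over a Noetherian base (E. Noether / Artin–Tate) -/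

section Noether

variable {R₀ : Type v} [CommRing R₀] [Algebra R₀ C] (hτ₀ : ∀ r : R₀, τ (algebraMap R₀ C r) = algebraMap R₀ C r)

include hτ₀ in
/-- **`C^τ` is of finite type over a Noetherian base `R₀ ⊆ C^τ` over which `C` is of finite type** (hence Noetherian), and `C` is
module-finite over it: returned as a finite set of invariants which, together with the image of `R₀`, generates `C^τ` as a ring.
[OURS · L1 W4.5c] -/
theorem exists_finset_closure_of_finiteType [IsNoetherianRing R₀] [Algebra.FiniteType R₀ C] {p : ℕ} (hp : 0 < p)
    (hτp : ∀ x : C, τ^[p] x = x) :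
    IsNoetherianRing (invariantSubring τ) ∧
      ∃ t : Finset C, (↑t : Set C) ⊆ invariantSubring τ ∧
        invariantSubring τ ≤ Subring.closure (Set.range (algebraMap R₀ C) ∪ ↑t) := by
  -- the invariants as an `R₀`-subalgebra
  let A' : Subalgebra R₀ C := { (invariantSubring τ).toSubsemiring with algebraMap_mem' := fun r => hτ₀ r }
  have hA' : ∀ x : C, x ∈ A' ↔ τ x = x := fun x => Iff.rfl
  -- `C` is integral (invariants of a finite group) and of finite type over `A'`, hence module-finite
  haveI := finite_zpowers_of_iterate_eq τ hp hτp
  haveI : Algebra.IsInvariant A' C (Subgroup.zpowers τ) :=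
    ⟨fun c hc => ⟨⟨c, (hA' c).mpr ((forall_smul_eq_iff τ c).mp hc)⟩, rfl⟩⟩
  haveI : SMulCommClass (Subgroup.zpowers τ) A' C :=
    ⟨fun g a c => by
      have ha : τ (algebraMap A' C a) = algebraMap A' C a := (hA' _).mp a.2
      rw [Algebra.smul_def, Algebra.smul_def, smul_mul', smul_eq_self_of_apply_eq τ ha g]⟩
  haveI : Algebra.IsIntegral A' C := Algebra.IsInvariant.isIntegral A' C (Subgroup.zpowers τ)
  haveI : Algebra.FiniteType A' C := Algebra.FiniteType.of_restrictScalars_finiteType R₀ A' C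
  haveI : Module.Finite A' C := Algebra.IsIntegral.finite
  -- Artin–Tate
  have hfg : (⊤ : Subalgebra R₀ A').FG :=
    fg_of_fg_of_fg R₀ A' C Algebra.FiniteType.out Module.Finite.fg_top Subtype.val_injective
  haveI : Algebra.FiniteType R₀ A' := ⟨hfg⟩
  haveI : IsNoetherianRing A' := Algebra.FiniteType.isNoetherianRing R₀ A'
  let e : A' ≃+* invariantSubring τ :=
    { toFun := fun x => ⟨x.1, x.2⟩, invFun := fun x => ⟨x.1, x.2⟩, left_inv := fun _ => rfl, right_inv := fun _ => rfl,
      map_mul' := fun _ _ => rfl, map_add' := fun _ _ => rfl }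
  refine ⟨isNoetherianRing_of_ringEquiv A' e, ?_⟩
  obtain ⟨t, ht⟩ := hfg
  classical
  refine ⟨t.image (fun x : A' => (x : C)), ?_, ?_⟩
  · intro x hx
    obtain ⟨y, -, rfl⟩ := Finset.mem_image.mp hx
    exact y.2
  · intro x hx
    have hx' : (⟨x, hx⟩ : A') ∈ Algebra.adjoin R₀ (t : Set A') := by rw [ht]; exact Algebra.mem_top
    have h2 : x ∈ (Algebra.adjoin R₀ (t : Set A')).map A'.val := Subalgebra.mem_map.mpr ⟨⟨x, hx⟩, hx', rfl⟩
    rw [AlgHom.map_adjoin] at h2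
    have h3 : x ∈ (Algebra.adjoin R₀ (A'.val '' (t : Set A'))).toSubring := h2
    rw [Algebra.adjoin_eq_ring_closure] at h3
    rwa [Finset.coe_image]

end Noether

end Summit.ResolutionOfSingularities.ResolutionOfSingularities.Theorems.WildQuotientResolution.S1.InvariantsRegular

end
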